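import Summits.QuantumFields.YangMills.Theorems.BalabanUVNodesN19CoreTVInvariant
import Summits.QuantumFields.YangMills.Theorems.BalabanUVNodesN19CoreMetric

/-!
# BalabanUVNodes ∕ N19 — THE MASS_cl ∧ TV_cl INVARIANT WITHOUT THE t-UNIFORM GOODNESS BINDER: necessity from the window's END POINTS
# (and t-locally), bootstrap on the classes good at both ends

Cell `pub-ymgap` (HUMAN RULING D-0062, Track A), node N19 = NE7, R134 seat `pub-ymgap-dag-n19-c` (g13).  SIBLING of this seat's g8 module 16b
`…Theorems.BalabanUVNodesN19CoreTVInvariant` (p504410), answering referee ref-F g7 READ-244 NIT-2 (bus l.18215): there, §1 `massSandwich_of_core_mgfForm`,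
§2 `tvSandwich_of_core_indicators` and the bootstrap `core_of_core_indicators` carry the t-UNIFORM GOODNESS binder
`∀ K t u, |t| ≤ l₀ → |u| ≤ l₀ → Bad K u ⊆ Bad K t`, which is symmetric in `(t, u)` and hence says `Bad K ·` is CONSTANT on the window, while
the proofs only ever use the faces `u = 0` and `u = l₀`.  This file DROPS the binder: every conclusion is stated on the classes the argument
actually needs to be good — at `t = 0` for the mass face, at `t = 0` AND at the second face `t` (or `l₀`) for the TV face — so that a consumer with a
genuinely t-DEPENDENT `Bad` (e.g. monotone in `|t|`: more classes turn bad as the source grows) can invoke them.  16b is untouched (append-only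
discipline; it had 3 lines of room); its binder versions are the special case `Bad K 0 ∪ Bad K l₀ ⊆ Bad K t` (`core_of_core_indicators_of_subset`).
Filed `--kind proof --supports` K3⁗ `SpineGivenEndpointR13Sep` = stmt-QuantumFields-20292 `--as helper` (dag-lead WORDS-140).  COUNT-NEUTRAL.  THEOREMS ONLY
(0 `def`); imports 16b + dag-n19-e's `…N19CoreMetric` (`core_of_subset` — restriction of `Core` to fewer good points — CITED, not restated); edits nothing.

WHAT IS PROVED ([folklore] ∕ bookkeeping; letters of 16b: common class spaces `Ω K`, class pieces `μA K τ`, `μB K τ`, TV_cl spelled out on sets).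
* §1 `massSandwich_of_core_mgfForm_zero`: `Core`'s `t = 0` face = MASS_cl(vol·δ) on `T K ∖ Bad K 0` — no binder, hypothesis `0 ≤ l₀` only.
* §2 ★ `tvSandwich_of_core_indicators_at` (t-LOCAL NECESSITY): if `Core … δ` holds for the dressed class terms of every indicator family, then for
  every `t` of the window with `t ≠ 0`, on every class good AT `0` AND AT `t` the normalised class laws are
  `(e^{2vol·δ_K} − 1)∕(1 − e^{−|t|})`-close on every measurable set (faces `u = 0` and `u = t` of `mgf 1_S = m + (e^u − 1)·μ(S)`; a NEGATIVE `t` is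
  read through the COMPLEMENT family `1_{Sᶜ}`, whose `u = t` face is `e^{t}·(m + (e^{|t|} − 1)·μ(S))`).  The constant blows up as `t → 0`, as it must:
  at `t = 0` the indicator cores see the class masses only.  `tvSandwich_of_core_indicators_ends` = the `t = l₀` instance: TV_cl with 16b's constant
  `(e^{2vol·δ_K} − 1)∕(1 − e^{−l₀})` on `T K ∖ (Bad K 0 ∪ Bad K l₀)`, no `t`, no binder.
* §3 ★ `core_of_core_indicators_ends` (BINDER-FREE BOOTSTRAP): the indicator cores carry every `B`-bounded observable family in MGF form, with ONE
  constant per `K`, on the classes good at both ends — `Core l₀ vol T (fun K _ => Bad K 0 ∪ Bad K l₀) P Q δ′` for every width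
  `vol·δ′_K ≥ vol·δ_K + (e^{2l₀B} − 1)(e^{2vol·δ_K} − 1)∕(1 − e^{−l₀})` (16b `core_of_mass_of_tv`, which never had the binder);
  `core_of_core_indicators_at`: the same with the TV face read at any `t₁ ≠ 0` of the window (bad sets `Bad K 0 ∪ Bad K t₁`, constant with `|t₁|`).
  `core_of_core_indicators_of_subset`: the ONE-DIRECTIONAL condition `Bad K 0 ∪ Bad K l₀ ⊆ Bad K t` on the window recovers the conclusion on `Bad`
  itself (16b's `core_of_core_indicators` is the case of a t-constant `Bad`); `core_of_core_indicators_of_monotone`: goodness monotone in `|t|`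
  (`|u| ≤ |t| ≤ l₀ ⇒ Bad K u ⊆ Bad K t`) ⇒ `Core` on the top-of-window bad sets `fun K _ => Bad K l₀`.
READING NOTE (READ-244 NIT-4).  16b's header sentence «[Balaban1987RG1] (0.4): RG images are densities» is a reading remark, not a locator: (0.4) of
RG-I (p.253) is the DEFINITION of the block-averaged variable; nothing there or here rests on it.

HONEST FRAMING.  [folklore] measure ∕ real arithmetic on hypothesis SHAPES (`Core`, `MGFForm`, MASS_cl, TV_cl); discharges nothing; every shape
produced by nobody; nothing of Bałaban's instantiated; NE7 NOT PRINTED as a two-run statement for d = 4 and NOT proved; N19 NOT discharged (0∕1); K3⁗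
NOT claimed; counts UNMOVED (typed 28∕28 · discharged 5∕27 · A 5∕28); one finite four-torus programme at fixed `ε` — NOT ℝ⁴, NOT OS, NOT a mass gap,
NOT Clay.  0 `def`; 0 `sorry`; standard axioms.
-/

set_option autoImplicit false

noncomputable section

open MeasureTheory ProbabilityTheory
open scoped ENNReal

namespace Summit.QuantumFields.YangMills.BalabanUVNodes.N19CoreTVInvariantEnds

open Summit.QuantumFields.BalabanUV.T4Continuum.NE1p.DressedMGFForm (MGFForm)
open Summit.QuantumFields.BalabanUV.T4Continuum.Spine.NE7 (Core)
open Summit.QuantumFields.YangMills.BalabanUVNodes.N19TVCurrency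
open Summit.QuantumFields.YangMills.BalabanUVNodes.N19CoreTVInvariant (core_of_mass_of_tv massSandwich_of_core_indicators)
open Summit.QuantumFields.YangMills.BalabanUVNodes.N19CoreMetric (core_of_subset)

/-! ## §0 Two lines of real arithmetic -/

section Arith

/-- The `u = t` face of the COMPLEMENT indicator family, rewritten on the set itself:
`m + (e^t − 1)·(m − s) = e^t·(m + (e^{−t} − 1)·s)`. [folklore] -/
theorem compl_face_eq (m s t : ℝ) :
    m + (Real.exp t - 1) * (m - s) = Real.exp t * (m + (Real.exp (-t) - 1) * s) := by
  have h : Real.exp t * Real.exp (-t) = 1 := by rw [← Real.exp_add, add_neg_cancel, Real.exp_zero]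
  linear_combination (-s) * h

/-- The necessity constant at `λ = e^s − 1`: `(E − 1)(1 + λ)∕λ = (E − 1)∕(1 − e^{−s})` for `s > 0`. [folklore] -/
theorem necessity_const_eq (E : ℝ) {s : ℝ} (hs : 0 < s) :
    (E - 1) * (1 + (Real.exp s - 1)) / (Real.exp s - 1) = (E - 1) / (1 - Real.exp (-s)) := by
  have hne : Real.exp s - 1 ≠ 0 := (sub_pos.2 (Real.one_lt_exp_iff.2 hs)).ne'
  have hne' : 1 - Real.exp (-s) ≠ 0 := by
    have : Real.exp (-s) < 1 := Real.exp_lt_one_iff.2 (by linarith)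
    linarith
  rw [div_eq_div_iff hne hne', Real.exp_neg]
  field_simp
  ring

/-- A common positive factor cancels from a two-sided sandwich. [folklore] -/
theorem sandwich_of_mul_sandwich {e a b X Y : ℝ} (he : 0 < e)
    (h : a * (e * X) ≤ e * Y ∧ e * Y ≤ b * (e * X)) : a * X ≤ Y ∧ Y ≤ b * X := by
  refine ⟨le_of_mul_le_mul_left ?_ he, le_of_mul_le_mul_left ?_ he⟩
  · have := mul_left_comm a e X; linarith [h.1]
  · have := mul_left_comm b e X; linarith [h.2]

end Arith

/-! ## §1 The mass face without the binder -/

section Leaf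

variable {ι : Type*} [DecidableEq ι] {Ω : ℕ → Type*} [∀ K, MeasurableSpace (Ω K)]
variable {l₀ vol B : ℝ} {T : ℕ → Finset ι} {Bad : ℕ → ℝ → Finset ι} {W : ∀ K, Ω K → ℝ}
  {μA μB : ∀ K, ι → Measure (Ω K)} {P Q : ℕ → ℝ → ι → ℝ} {δ δ' : ℕ → ℝ}

/-- The one-set family `K ↦ (K = K₀ ? S : ∅)` used to probe a single class space is measurable. [bookkeeping] -/
theorem measurableSet_update_empty (K : ℕ) {S : Set (Ω K)} (hS : MeasurableSet S) (K' : ℕ) :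
    MeasurableSet (Function.update (fun K'' => (∅ : Set (Ω K''))) K S K') := by
  by_cases hK : K' = K
  · subst hK; rw [Function.update_self]; exact hS
  · rw [Function.update_of_ne hK]; exact MeasurableSet.empty

/-- **(V) IN MASS LETTERS, BINDER-FREE.**  `Spine.NE7.Core` for ONE pair of MGF-form class terms (same spaces, one observable family) gives
MASS_cl(vol·δ) on the classes good AT `t = 0` — its `t = 0` face read through `MGFForm.zero_eq`; hypothesis `0 ≤ l₀` (so that `0` is in the
window) and nothing on `Bad`.  16b's `massSandwich_of_core_mgfForm` is this on `T K ∖ Bad K t ⊆ T K ∖ Bad K 0`. [bookkeeping] -/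
theorem massSandwich_of_core_mgfForm_zero (hP : MGFForm B T W μA P) (hQ : MGFForm B T W μB Q) (hl₀ : 0 ≤ l₀)
    (h : Core l₀ vol T Bad P Q δ) :
    ∀ K : ℕ, ∃ c : ℝ, ∀ τ ∈ T K \ Bad K 0,
      ENNReal.ofReal (Real.exp (c - vol * δ K)) * μA K τ Set.univ ≤ μB K τ Set.univ ∧
        μB K τ Set.univ ≤ ENNReal.ofReal (Real.exp (c + vol * δ K)) * μA K τ Set.univ := by
  intro K
  obtain ⟨c, hc⟩ := h K
  refine ⟨c, fun τ hτ => ?_⟩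
  have hτT : τ ∈ T K := (Finset.mem_sdiff.mp hτ).1
  haveI := hP.finite K τ hτT; haveI := hQ.finite K τ hτT
  have h0 : |(0 : ℝ)| ≤ l₀ := by rwa [abs_zero]
  have key := hc 0 h0 τ hτ
  rw [hP.zero_eq K hτT, hQ.zero_eq K hτT] at key
  exact ennreal_sandwich_of_real (Real.exp_pos _).le (Real.exp_pos _).le key

/-! ## §2 Necessity without the binder: the classes good at `0` and at the second face -/

/-- ★ **t-LOCAL NECESSITY: TV_cl ON THE CLASSES GOOD AT `0` AND AT `t`.**  Finite class pieces of the two runs on COMMON class spaces, `0 ≤ vol·δ`.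
If `Spine.NE7.Core l₀ vol T Bad … δ` holds for the dressed class terms of EVERY indicator observable family `1_{S K}` (the constant may depend
on the family), then for every `t ≠ 0` of the window and every class `τ` good at `0` and at `t`, the two runs' NORMALISED class laws satisfy
`|μB(S)∕μB(Ω) − μA(S)∕μA(Ω)| ≤ (e^{2vol·δ_K} − 1)∕(1 − e^{−|t|})` on every measurable `S` (massless classes read `0 − 0`).  Mechanism: the `u = 0`
face pins the constant to the mass ratio; for `t > 0` the `u = t` face of `mgf 1_S = m + (e^t − 1)·μ(S)` pins `μ(S)∕m`
(`N19TVCurrency.abs_div_sub_div_le_of_sandwiches` with `λ = e^t − 1`); for `t < 0` the SAME arithmetic is fed by the complement family `1_{Sᶜ}`, whose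
`u = t` face is `e^t·(m + (e^{|t|} − 1)·μ(S))` (`compl_face_eq`), the common factor `e^t` cancelling in the two-sided sandwich.  NO hypothesis on
`Bad`. [folklore] -/
theorem tvSandwich_of_core_indicators_at (hfinA : ∀ K, ∀ τ ∈ T K, IsFiniteMeasure (μA K τ))
    (hfinB : ∀ K, ∀ τ ∈ T K, IsFiniteMeasure (μB K τ)) (hvol : 0 ≤ vol) (hδ : ∀ K, 0 ≤ δ K)
    (hCore : ∀ S : ∀ K, Set (Ω K), (∀ K, MeasurableSet (S K)) →
      Core l₀ vol T Bad (fun K t τ => mgf ((S K).indicator 1) (μA K τ) t)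
        (fun K t τ => mgf ((S K).indicator 1) (μB K τ) t) δ) :
    ∀ (K : ℕ) (t : ℝ), t ≠ 0 → |t| ≤ l₀ → ∀ τ ∈ T K \ (Bad K 0 ∪ Bad K t), ∀ S : Set (Ω K), MeasurableSet S →
      |(μB K τ).real S / (μB K τ).real Set.univ - (μA K τ).real S / (μA K τ).real Set.univ| ≤
        (Real.exp (2 * (vol * δ K)) - 1) / (1 - Real.exp (-|t|)) := by
  intro K t ht0 ht τ hτ S hS
  rw [Finset.mem_sdiff, Finset.notMem_union] at hτ
  have hτT : τ ∈ T K := hτ.1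
  have hτ0 : τ ∈ T K \ Bad K 0 := Finset.mem_sdiff.2 ⟨hτT, hτ.2.1⟩
  have hτt : τ ∈ T K \ Bad K t := Finset.mem_sdiff.2 ⟨hτT, hτ.2.2⟩
  haveI := hfinA K τ hτT; haveI := hfinB K τ hτT
  have h0 : |(0 : ℝ)| ≤ l₀ := by rw [abs_zero]; exact (abs_nonneg t).trans ht
  have hs : 0 < |t| := abs_pos.2 ht0
  have hlam : 0 < Real.exp |t| - 1 := sub_pos.2 (Real.one_lt_exp_iff.2 hs)
  -- the two faces, in the letters of the necessity arithmetic, from ONE indicator family (so with ONE constant)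
  have faces : ∃ c : ℝ,
      (Real.exp (c - vol * δ K) * (μA K τ).real Set.univ ≤ (μB K τ).real Set.univ ∧
        (μB K τ).real Set.univ ≤ Real.exp (c + vol * δ K) * (μA K τ).real Set.univ) ∧
      (Real.exp (c - vol * δ K) * ((μA K τ).real Set.univ + (Real.exp |t| - 1) * (μA K τ).real S) ≤
          (μB K τ).real Set.univ + (Real.exp |t| - 1) * (μB K τ).real S ∧
        (μB K τ).real Set.univ + (Real.exp |t| - 1) * (μB K τ).real S ≤
          Real.exp (c + vol * δ K) * ((μA K τ).real Set.univ + (Real.exp |t| - 1) * (μA K τ).real S)) := by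
    rcases lt_or_gt_of_ne ht0 with hneg | hpos
    · -- negative `t`: probe with the COMPLEMENT family
      set Sf : ∀ K', Set (Ω K') := Function.update (fun K' => (∅ : Set (Ω K'))) K Sᶜ with hSf
      have hSK : Sf K = Sᶜ := by rw [hSf, Function.update_self]
      obtain ⟨c, hc⟩ := hCore Sf (measurableSet_update_empty K hS.compl) K
      refine ⟨c, ?_, ?_⟩
      · have k0 := hc 0 h0 τ hτ0
        simp only [hSK, mgf_indicator_one _ hS.compl, Real.exp_zero, sub_self, zero_mul, add_zero] at k0
        exact k0
      · have k1 := hc t ht τ hτt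
        simp only [hSK, mgf_indicator_one _ hS.compl, measureReal_compl hS, compl_face_eq] at k1
        rw [abs_of_neg hneg]
        exact sandwich_of_mul_sandwich (Real.exp_pos t) k1
    · -- positive `t`: probe with the family itself
      set Sf : ∀ K', Set (Ω K') := Function.update (fun K' => (∅ : Set (Ω K'))) K S with hSf
      have hSK : Sf K = S := by rw [hSf, Function.update_self]
      obtain ⟨c, hc⟩ := hCore Sf (measurableSet_update_empty K hS) K
      refine ⟨c, ?_, ?_⟩
      · have k0 := hc 0 h0 τ hτ0
        simp only [hSK, mgf_indicator_one _ hS, Real.exp_zero, sub_self, zero_mul, add_zero] at k0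
        exact k0
      · have k1 := hc t ht τ hτt
        simp only [hSK, mgf_indicator_one _ hS] at k1
        rw [abs_of_pos hpos]
        exact k1
  obtain ⟨c, k0, k1⟩ := faces
  have hmain := abs_div_sub_div_le_of_sandwiches measureReal_nonneg measureReal_nonneg
    (measureReal_mono (Set.subset_univ S)) measureReal_nonneg (measureReal_mono (Set.subset_univ S)) hlam
    (mul_nonneg hvol (hδ K)) k0 k1
  rw [← necessity_const_eq _ hs]
  exact hmain

/-- ★ **NECESSITY AT THE END POINTS, BINDER-FREE.**  `0 < l₀`, `0 ≤ vol·δ`; `Core … δ` for the dressed class terms of every indicator family ⇒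
on every class good AT `0` AND AT `l₀` the normalised class laws are `(e^{2vol·δ_K} − 1)∕(1 − e^{−l₀})`-close on every measurable set — 16b's
`tvSandwich_of_core_indicators` with the t-uniform goodness binder replaced by NOTHING (the statement has no `t`: TV_cl is a property of the class
pieces).  The `t = l₀` instance of `tvSandwich_of_core_indicators_at`. [folklore] -/
theorem tvSandwich_of_core_indicators_ends (hfinA : ∀ K, ∀ τ ∈ T K, IsFiniteMeasure (μA K τ))
    (hfinB : ∀ K, ∀ τ ∈ T K, IsFiniteMeasure (μB K τ)) (hl₀ : 0 < l₀) (hvol : 0 ≤ vol) (hδ : ∀ K, 0 ≤ δ K)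
    (hCore : ∀ S : ∀ K, Set (Ω K), (∀ K, MeasurableSet (S K)) →
      Core l₀ vol T Bad (fun K t τ => mgf ((S K).indicator 1) (μA K τ) t)
        (fun K t τ => mgf ((S K).indicator 1) (μB K τ) t) δ) :
    ∀ K : ℕ, ∀ τ ∈ T K \ (Bad K 0 ∪ Bad K l₀), ∀ S : Set (Ω K), MeasurableSet S →
      |(μB K τ).real S / (μB K τ).real Set.univ - (μA K τ).real S / (μA K τ).real Set.univ| ≤
        (Real.exp (2 * (vol * δ K)) - 1) / (1 - Real.exp (-l₀)) := by
  intro K τ hτ S hS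
  have h := tvSandwich_of_core_indicators_at hfinA hfinB hvol hδ hCore K l₀ hl₀.ne' (abs_of_pos hl₀).le τ hτ S hS
  rwa [abs_of_pos hl₀] at h

/-! ## §3 The bootstrap without the binder -/

/-- ★ **BINDER-FREE BOOTSTRAP: THE INDICATOR CORES CARRY EVERY BOUNDED OBSERVABLE ON THE CLASSES GOOD AT BOTH ENDS.**  If
`Spine.NE7.Core … δ` holds for the dressed class terms of every indicator observable family (finite common class pieces, `0 < l₀`, `0 ≤ vol`,
`0 ≤ δ` — and NO goodness binder), then for the MGF-form class terms of EVERY `B`-bounded measurable observable family, with ONE constant per `K`,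
`Core l₀ vol T (fun K _ => Bad K 0 ∪ Bad K l₀) P Q δ′` for every width `vol·δ′_K ≥ vol·δ_K + (e^{2l₀B} − 1)·(e^{2vol·δ_K} − 1)∕(1 − e^{−l₀})`
(`massSandwich_of_core_indicators` + `tvSandwich_of_core_indicators_ends` → 16b `core_of_mass_of_tv`, which never had the binder).  The bad
sets of the conclusion are t-CONSTANT by nature: TV_cl is a property of the pieces, read off the faces `0` and `l₀`. [folklore] -/
theorem core_of_core_indicators_ends (hP : MGFForm B T W μA P) (hQ : MGFForm B T W μB Q) (hl₀ : 0 < l₀) (hvol : 0 ≤ vol)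
    (hδ : ∀ K, 0 ≤ δ K)
    (hCore : ∀ S : ∀ K, Set (Ω K), (∀ K, MeasurableSet (S K)) →
      Core l₀ vol T Bad (fun K t τ => mgf ((S K).indicator 1) (μA K τ) t)
        (fun K t τ => mgf ((S K).indicator 1) (μB K τ) t) δ)
    (hw : ∀ K, vol * δ K + (Real.exp (2 * (l₀ * B)) - 1) * ((Real.exp (2 * (vol * δ K)) - 1) / (1 - Real.exp (-l₀))) ≤
      vol * δ' K) :
    Core l₀ vol T (fun K _ => Bad K 0 ∪ Bad K l₀) P Q δ' := by
  have hsub : ∀ (K : ℕ) (t : ℝ), T K \ (Bad K 0 ∪ Bad K l₀) ⊆ T K \ Bad K 0 := fun K t =>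
    Finset.sdiff_subset_sdiff (Finset.Subset.refl _) Finset.subset_union_left
  have hM := massSandwich_of_core_indicators (l₀ := l₀) (Bad := Bad) hP.finite hQ.finite hCore
  refine core_of_mass_of_tv (r₁ := fun K => vol * δ K) (ρ := fun K => (Real.exp (2 * (vol * δ K)) - 1) / (1 - Real.exp (-l₀)))
    hP hQ (fun K => ?_) (fun K t _ τ hτ S hS => tvSandwich_of_core_indicators_ends hP.finite hQ.finite hl₀ hvol hδ hCore K τ hτ S hS) hw
  obtain ⟨c, hc⟩ := hM K
  have h0 : |(0 : ℝ)| ≤ l₀ := by rw [abs_zero]; exact hl₀.le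
  exact ⟨c, fun t _ τ hτ => hc 0 h0 τ (hsub K t hτ)⟩

/-- **BOOTSTRAP WITH A CHOSEN SECOND FACE.**  Same, with the TV face read at any `t₁ ≠ 0` of the window instead of `l₀`: `Core` for every bounded
observable family on the classes good at `0` and at `t₁`, `Core l₀ vol T (fun K _ => Bad K 0 ∪ Bad K t₁) P Q δ′`, for every width
`vol·δ′_K ≥ vol·δ_K + (e^{2l₀B} − 1)·(e^{2vol·δ_K} − 1)∕(1 − e^{−|t₁|})`.  Under monotone goodness a smaller `|t₁|` excludes FEWER classes at the price
of a larger constant — the trade-off is the consumer's. [folklore] -/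
theorem core_of_core_indicators_at (hP : MGFForm B T W μA P) (hQ : MGFForm B T W μB Q) (hvol : 0 ≤ vol) (hδ : ∀ K, 0 ≤ δ K)
    {t₁ : ℝ} (ht₁ : t₁ ≠ 0) (ht₁l : |t₁| ≤ l₀)
    (hCore : ∀ S : ∀ K, Set (Ω K), (∀ K, MeasurableSet (S K)) →
      Core l₀ vol T Bad (fun K t τ => mgf ((S K).indicator 1) (μA K τ) t)
        (fun K t τ => mgf ((S K).indicator 1) (μB K τ) t) δ)
    (hw : ∀ K, vol * δ K + (Real.exp (2 * (l₀ * B)) - 1) * ((Real.exp (2 * (vol * δ K)) - 1) / (1 - Real.exp (-|t₁|))) ≤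
      vol * δ' K) :
    Core l₀ vol T (fun K _ => Bad K 0 ∪ Bad K t₁) P Q δ' := by
  have hsub : ∀ (K : ℕ) (t : ℝ), T K \ (Bad K 0 ∪ Bad K t₁) ⊆ T K \ Bad K 0 := fun K t =>
    Finset.sdiff_subset_sdiff (Finset.Subset.refl _) Finset.subset_union_left
  have hM := massSandwich_of_core_indicators (l₀ := l₀) (Bad := Bad) hP.finite hQ.finite hCore
  refine core_of_mass_of_tv (r₁ := fun K => vol * δ K) (ρ := fun K => (Real.exp (2 * (vol * δ K)) - 1) / (1 - Real.exp (-|t₁|)))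
    hP hQ (fun K => ?_)
    (fun K t _ τ hτ S hS => tvSandwich_of_core_indicators_at hP.finite hQ.finite hvol hδ hCore K t₁ ht₁ ht₁l τ hτ S hS) hw
  obtain ⟨c, hc⟩ := hM K
  have h0 : |(0 : ℝ)| ≤ l₀ := by rw [abs_zero]; exact (abs_nonneg t₁).trans ht₁l
  exact ⟨c, fun t _ τ hτ => hc 0 h0 τ (hsub K t hτ)⟩

/-- **THE ONE-DIRECTIONAL BINDER RECOVERS THE CONCLUSION ON `Bad` ITSELF.**  If on the window every class good at `t` is good at `0` and at `l₀`
(`Bad K 0 ∪ Bad K l₀ ⊆ Bad K t` — ONE inclusion, not the symmetric binder; a t-dependent `Bad` is allowed), the binder-free bootstrap restricts to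
`Core l₀ vol T Bad P Q δ′` (dag-n19-e `N19CoreMetric.core_of_subset`).  16b's `core_of_core_indicators` is the case of its symmetric binder. [bookkeeping] -/
theorem core_of_core_indicators_of_subset (hP : MGFForm B T W μA P) (hQ : MGFForm B T W μB Q) (hl₀ : 0 < l₀) (hvol : 0 ≤ vol)
    (hδ : ∀ K, 0 ≤ δ K) (hsub : ∀ (K : ℕ) (t : ℝ), |t| ≤ l₀ → Bad K 0 ∪ Bad K l₀ ⊆ Bad K t)
    (hCore : ∀ S : ∀ K, Set (Ω K), (∀ K, MeasurableSet (S K)) →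
      Core l₀ vol T Bad (fun K t τ => mgf ((S K).indicator 1) (μA K τ) t)
        (fun K t τ => mgf ((S K).indicator 1) (μB K τ) t) δ)
    (hw : ∀ K, vol * δ K + (Real.exp (2 * (l₀ * B)) - 1) * ((Real.exp (2 * (vol * δ K)) - 1) / (1 - Real.exp (-l₀))) ≤
      vol * δ' K) :
    Core l₀ vol T Bad P Q δ' :=
  core_of_subset le_rfl (fun K t ht => Finset.sdiff_subset_sdiff (Finset.Subset.refl _) (hsub K t ht))
    (core_of_core_indicators_ends hP hQ hl₀ hvol hδ hCore hw)

/-- **MONOTONE GOODNESS.**  If the bad classes grow with the source strength (`|u| ≤ |t| ≤ l₀ ⇒ Bad K u ⊆ Bad K t` — the natural t-DEPENDENT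
shape), then `Bad K 0 ∪ Bad K l₀ = Bad K l₀` and the binder-free bootstrap reads: `Core` for every bounded observable family on the classes good at
the TOP of the window, `Core l₀ vol T (fun K _ => Bad K l₀) P Q δ′`. [bookkeeping] -/
theorem core_of_core_indicators_of_monotone (hP : MGFForm B T W μA P) (hQ : MGFForm B T W μB Q) (hl₀ : 0 < l₀) (hvol : 0 ≤ vol)
    (hδ : ∀ K, 0 ≤ δ K) (hmono : ∀ (K : ℕ) (t u : ℝ), |u| ≤ |t| → |t| ≤ l₀ → Bad K u ⊆ Bad K t)
    (hCore : ∀ S : ∀ K, Set (Ω K), (∀ K, MeasurableSet (S K)) →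
      Core l₀ vol T Bad (fun K t τ => mgf ((S K).indicator 1) (μA K τ) t)
        (fun K t τ => mgf ((S K).indicator 1) (μB K τ) t) δ)
    (hw : ∀ K, vol * δ K + (Real.exp (2 * (l₀ * B)) - 1) * ((Real.exp (2 * (vol * δ K)) - 1) / (1 - Real.exp (-l₀))) ≤
      vol * δ' K) :
    Core l₀ vol T (fun K _ => Bad K l₀) P Q δ' := by
  have hl : |l₀| ≤ l₀ := (abs_of_pos hl₀).le
  have h0l : ∀ K, Bad K 0 ⊆ Bad K l₀ := fun K => hmono K l₀ 0 (by rw [abs_zero]; exact abs_nonneg _) hl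
  refine core_of_subset le_rfl (fun K t _ => Finset.sdiff_subset_sdiff (Finset.Subset.refl _) ?_)
    (core_of_core_indicators_ends hP hQ hl₀ hvol hδ hCore hw)
  exact Finset.union_subset (h0l K) (Finset.Subset.refl _)

end Leaf

end Summit.QuantumFields.YangMills.BalabanUVNodes.N19CoreTVInvariantEnds

end
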